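import Summits.KontsevichZagierPeriods.KontsevichZagierPeriods.Theorems.SoloBlindTwelveSporadicPrep
import HarnessLib

/-!
# The sporadic class at level 12: the pull-back identities

With `F`, `τ`, `P₀`, `P₁`, `w₀` from `SoloBlindTwelveSporadicPrep` and `C = √P₀`, the common
pulled-back integrand is

  `η(W) = C · W^{-1/2} (1-W²)^{-5/6} (W + w₀)`.

This file proves, by comparing sixth powers of positive quantities,

* `η(W) = t^{-2/3}(1-t)^{-1/2}|_{t=F(W)} · |F'(W)|` on `(0,P₀)`   (`sp_pullF`),
* `η(W) = t^{-2/3}(1-t)^{-5/6}|_{t=τ(W)} · |τ'(W)|` on `(P₀,1)`   (`sp_pullT`),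

and, along `s = W²`, `η = (C/2) g₊ + (C w₀/2) g₀` with
`g₊(W) = s^{-1/4}(1-s)^{-5/6}|_{s=W²}·2W`, `g₀(W) = s^{-3/4}(1-s)^{-5/6}|_{s=W²}·2W`
(`sp_sqGp`, `sp_sqG0`, `spEta_eq_add`), together with the integrability and
`ℚ`-semialgebraicity facts needed to run these substitutions inside the Kontsevich–Zagier rules
(`SoloBlindTwelveSporadic`).

References: P. Deligne (appendix by N. Koblitz, A. Ogus), Proc. Symp. Pure Math. 33 (1979);
M. Kontsevich, D. Zagier, *Periods* (2001), §1.2.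
-/

noncomputable section

open Set MeasureTheory MvPolynomial

namespace Summit.KontsevichZagierPeriods.KontsevichZagierPeriods.Theorems

namespace SoloBlind

open Literature.ModelTheory.ExponentialFields (IsSemialgebraic)
open Literature.NumberTheory.Transcendental
open Literature.NumberTheory.Transcendental.KZ

/-! ## The constant `C = √P₀` -/

/-- `C = √P₀ ≈ 0.82538`. -/
def spC : ℝ := Real.sqrt sP0

/-- `0 < C`. -/
theorem spC_pos : 0 < spC := Real.sqrt_pos.mpr sP0_pos

/-- `C² = P₀`. -/
theorem spC_sq : spC ^ 2 = sP0 := Real.sq_sqrt sP0_pos.le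

/-- `C⁶ = P₀³`. -/
theorem spC_pow_six : spC ^ 6 = sP0 ^ 3 := by
  rw [show (6:ℕ) = 2 * 3 by norm_num, pow_mul, spC_sq]

/-- `C` is algebraic. -/
theorem isAlgebraic_spC : IsAlgebraic ℚ spC :=
  IsAlgebraic.of_pow two_pos (by rw [spC_sq]; exact isAlgebraic_sP0)

/-- `C` as an element of `K₀`. -/
def spCK : K₀ := ⟨spC, mem_K₀_iff.mpr isAlgebraic_spC⟩

/-- `((C : K₀) : ℝ) = C`. -/
@[simp] theorem coe_spCK : ((spCK : K₀) : ℝ) = spC := rfl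

/-! ## The integrands -/

/-- `η(W) = C · W^{-1/2} (1-W²)^{-5/6} (W + w₀)`, the common pull-back. -/
def spEta (W : ℝ) : ℝ := spC * (W ^ (-(1 / 2 : ℝ)) * (1 - W ^ 2) ^ (-(5 / 6 : ℝ)) * (W + sW0))

/-- `g₊(W) = 2W · W^{-1/2}(1-W²)^{-5/6}` (the form `s^{-1/4}(1-s)^{-5/6} ds` along `s = W²`). -/
def spGp (W : ℝ) : ℝ := 2 * W * (W ^ (-(1 / 2 : ℝ)) * (1 - W ^ 2) ^ (-(5 / 6 : ℝ)))

/-- `g₀(W) = 2 · W^{-1/2}(1-W²)^{-5/6}` (the form `s^{-3/4}(1-s)^{-5/6} ds` along `s = W²`). -/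
def spG0 (W : ℝ) : ℝ := 2 * (W ^ (-(1 / 2 : ℝ)) * (1 - W ^ 2) ^ (-(5 / 6 : ℝ)))

/-- `η = (C/2) g₊ + (C w₀/2) g₀` identically. -/
theorem spEta_eq_add (W : ℝ) : spEta W = spC / 2 * spGp W + spC * sW0 / 2 * spG0 W := by
  unfold spEta spGp spG0; ring

/-- `η > 0` on `(0,1)`. -/
theorem spEta_pos {W : ℝ} (hW : W ∈ Ioo (0:ℝ) 1) : 0 < spEta W := by
  obtain ⟨h0, h1⟩ := hW
  have hq : 0 < 1 - W ^ 2 := by nlinarith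
  unfold spEta
  exact mul_pos spC_pos (mul_pos (mul_pos (Real.rpow_pos_of_pos h0 _)
    (Real.rpow_pos_of_pos hq _)) (by linarith [sW0_pos]))

/-! ## Powers -/

/-- `(t^e)^6 = t^k` for `t > 0` and `6e = k ∈ ℤ`. -/
theorem rpow_pow_six {t : ℝ} (ht : 0 < t) {e : ℝ} {k : ℤ} (h : e * 6 = k) :
    (t ^ e) ^ (6:ℕ) = t ^ k := by
  rw [← Real.rpow_natCast, ← Real.rpow_mul ht.le, Nat.cast_ofNat, h, Real.rpow_intCast]

/-- `η(W)⁶ = P₀³ · W⁻³ (1-W²)⁻⁵ (W+w₀)⁶`. -/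
theorem spEta_pow_six {W : ℝ} (hW : W ∈ Ioo (0:ℝ) 1) :
    spEta W ^ 6 = sP0 ^ 3 * (W ^ (-3:ℤ) * (1 - W ^ 2) ^ (-5:ℤ) * (W + sW0) ^ 6) := by
  obtain ⟨h0, h1⟩ := hW
  have hq : 0 < 1 - W ^ 2 := by nlinarith
  unfold spEta
  simp only [mul_pow]
  rw [spC_pow_six, rpow_pow_six h0 (k := -3) (by norm_num),
    rpow_pow_six hq (k := -5) (by norm_num)]

/-! ## The two pull-backs along `F` and `τ` -/

/-- **Pull-back along `F` on `(0,P₀)`:** `t^{-2/3}(1-t)^{-1/2}|_{t=F} |F'| = η`. -/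
theorem sp_pullF {W : ℝ} (hW : W ∈ Ioo 0 sP0) :
    spEta W = betaFun (1 / 3) (1 / 2) (spF W) * |spF' W| := by
  obtain ⟨h0, hP⟩ := hW
  have h1 : W < 1 := hP.trans sP0_lt_one
  have hA : 0 < sP0 - W := by linarith
  have hB : 0 < sP1 - W := by linarith [one_lt_sP1]
  have hq : 0 < 1 - W ^ 2 := by nlinarith
  have hm : 0 < W + sW0 := by linarith [sW0_pos]
  have hp : 0 < sP0 := sP0_pos
  have hA' := hA.ne'
  have hB' := hB.ne'
  have hq' := hq.ne'
  have hm' := hm.ne'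
  have hp' := hp.ne'
  have h0' := h0.ne'
  have hF : 0 < spF W := (spF_mem ⟨h0, hP⟩).1
  have hX : 0 < W * (sP1 - W) ^ 2 / (sP0 ^ 3 * (1 - W ^ 2)) := by positivity
  have hY : 0 < (sP0 - W) ^ 2 * (sP1 - W) * (W + sW0) / (sP0 ^ 3 * (1 - W ^ 2) ^ 2) := by
    positivity
  rw [betaFun, one_sub_spF h0 h1, abs_spF' ⟨h0, hP⟩]
  refine (pow_left_inj₀ (spEta_pos ⟨h0, h1⟩).le
    (mul_pos (mul_pos (Real.rpow_pos_of_pos hF _) (Real.rpow_pos_of_pos hX _)) hY).le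
    (by norm_num : (6:ℕ) ≠ 0)).mp ?_
  rw [spEta_pow_six ⟨h0, h1⟩, mul_pow, mul_pow,
    rpow_pow_six hF (k := -4) (by push_cast; norm_num),
    rpow_pow_six hX (k := -3) (by push_cast; norm_num)]
  simp only [spF, zpow_neg, zpow_ofNat]
  field_simp

/-- **Pull-back along `τ` on `(P₀,1)`:** `t^{-2/3}(1-t)^{-5/6}|_{t=τ} |τ'| = η`. -/
theorem sp_pullT {W : ℝ} (hW : W ∈ Ioo sP0 1) :
    spEta W = betaFun (1 / 3) (1 / 6) (spT W) * |spT' W| := by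
  obtain ⟨hP, h1⟩ := hW
  have h0 : 0 < W := sP0_pos.trans hP
  have hA : 0 < W - sP0 := by linarith
  have hB : 0 < sP1 - W := by linarith [one_lt_sP1]
  have hq : 0 < 1 - W ^ 2 := by nlinarith
  have hm : 0 < W + sW0 := by linarith [sW0_pos]
  have hp : 0 < sP0 := sP0_pos
  have hA' := hA.ne'
  have hB' := hB.ne'
  have hq' := hq.ne'
  have hm' := hm.ne'
  have hp' := hp.ne'
  have h0' := h0.ne'
  have hT : 0 < spT W := (spT_mem ⟨hP, h1⟩).1
  have hX : 0 < sP0 ^ 3 * (1 - W ^ 2) / (W * (sP1 - W) ^ 2) := by positivity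
  have hY : 0 < spT' W := spT'_pos ⟨hP, h1⟩
  rw [betaFun, one_sub_spT h0 h1, abs_of_pos hY]
  refine (pow_left_inj₀ (spEta_pos ⟨h0, h1⟩).le
    (mul_pos (mul_pos (Real.rpow_pos_of_pos hT _) (Real.rpow_pos_of_pos hX _)) hY).le
    (by norm_num : (6:ℕ) ≠ 0)).mp ?_
  rw [spEta_pow_six ⟨h0, h1⟩, mul_pow, mul_pow,
    rpow_pow_six hT (k := -4) (by push_cast; norm_num),
    rpow_pow_six hX (k := -5) (by push_cast; norm_num)]
  simp only [spT, spT', zpow_neg, zpow_ofNat]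
  field_simp

/-! ## The substitution `s = W²` -/

/-- `g₊(W) = s^{-1/4}(1-s)^{-5/6}|_{s=W²} · |2W|` on `(0,1)`. -/
theorem sp_sqGp {W : ℝ} (hW : W ∈ Ioo (0:ℝ) 1) :
    spGp W = betaFun (3 / 4) (1 / 6) (W ^ 2) * |2 * W| := by
  have h0 := hW.1
  have hsq : ∀ e : ℝ, (W ^ 2) ^ e = W ^ (2 * e) := fun e => by
    rw [← Real.rpow_natCast W 2, ← Real.rpow_mul h0.le]; norm_num
  rw [betaFun, hsq, abs_of_pos (by linarith), spGp,
    show (2:ℝ) * (((3 / 4 : ℚ) : ℝ) - 1) = -(1 / 2 : ℝ) by push_cast; norm_num,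
    show (((1 / 6 : ℚ) : ℝ) - 1) = -(5 / 6 : ℝ) by push_cast; norm_num]
  ring

/-- `g₀(W) = s^{-3/4}(1-s)^{-5/6}|_{s=W²} · |2W|` on `(0,1)`. -/
theorem sp_sqG0 {W : ℝ} (hW : W ∈ Ioo (0:ℝ) 1) :
    spG0 W = betaFun (1 / 4) (1 / 6) (W ^ 2) * |2 * W| := by
  have h0 := hW.1
  have hsq : ∀ e : ℝ, (W ^ 2) ^ e = W ^ (2 * e) := fun e => by
    rw [← Real.rpow_natCast W 2, ← Real.rpow_mul h0.le]; norm_num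
  have e : W ^ (-(1 / 2 : ℝ)) = W ^ (-(3 / 2 : ℝ)) * W := by
    rw [← Real.rpow_add_one h0.ne']; norm_num
  rw [betaFun, hsq, abs_of_pos (by linarith), spG0, e,
    show (2:ℝ) * (((1 / 4 : ℚ) : ℝ) - 1) = -(3 / 2 : ℝ) by push_cast; norm_num,
    show (((1 / 6 : ℚ) : ℝ) - 1) = -(5 / 6 : ℝ) by push_cast; norm_num]
  ring

/-- The square map is injective on `(0,1)`. -/
theorem injOn_sq_unit : InjOn (fun W : ℝ => W ^ 2) (Ioo (0:ℝ) 1) := fun _ hx _ hy h =>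
  (pow_left_inj₀ hx.1.le hy.1.le two_ne_zero).mp h

/-- The square map sends `(0,1)` onto `(0,1)`. -/
theorem image_sq_unit : Ioo (0:ℝ) 1 = (fun W : ℝ => W ^ 2) '' Ioo (0:ℝ) 1 := by
  ext s
  constructor
  · rintro ⟨h0, h1⟩
    exact ⟨Real.sqrt s, ⟨Real.sqrt_pos.mpr h0, (Real.sqrt_lt_sqrt h0.le h1).trans_eq Real.sqrt_one⟩,
      Real.sq_sqrt h0.le⟩
  · rintro ⟨W, ⟨h0, h1⟩, rfl⟩
    exact ⟨by positivity, by nlinarith⟩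

/-! ## Integrability -/

/-- `g₊` is integrable on `(0,1)` (pull back the Beta integrand along `W²`). -/
theorem integrableOn_spGp : IntegrableOn spGp (Ioo 0 1) := by
  have h := integrableOn_betaFun (3 / 4) (1 / 6) (by norm_num) (by norm_num)
  rw [image_sq_unit, integrableOn_image_iff_integrableOn_abs_deriv_smul measurableSet_Ioo
    (fun u _ => (hasDerivAt_sq u).hasDerivWithinAt) injOn_sq_unit] at h
  exact h.congr_fun (fun u hu => by simp only [smul_eq_mul]; rw [mul_comm, ← sp_sqGp hu])
    measurableSet_Ioo

/-- `g₀` is integrable on `(0,1)`. -/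
theorem integrableOn_spG0 : IntegrableOn spG0 (Ioo 0 1) := by
  have h := integrableOn_betaFun (1 / 4) (1 / 6) (by norm_num) (by norm_num)
  rw [image_sq_unit, integrableOn_image_iff_integrableOn_abs_deriv_smul measurableSet_Ioo
    (fun u _ => (hasDerivAt_sq u).hasDerivWithinAt) injOn_sq_unit] at h
  exact h.congr_fun (fun u hu => by simp only [smul_eq_mul]; rw [mul_comm, ← sp_sqG0 hu])
    measurableSet_Ioo

/-- `η` is integrable on `(0,1)`. -/
theorem integrableOn_spEta : IntegrableOn spEta (Ioo 0 1) := by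
  have h : spEta = fun W => spC / 2 * spGp W + spC * sW0 / 2 * spG0 W := funext spEta_eq_add
  rw [h]
  exact (integrableOn_spGp.const_mul _).add (integrableOn_spG0.const_mul _)

/-- `η` is integrable on `(0,P₀)`. -/
theorem integrableOn_spEta_left : IntegrableOn spEta (Ioo 0 sP0) :=
  integrableOn_spEta.mono_set (Ioo_subset_Ioo_right sP0_lt_one.le)

/-- `η` is integrable on `(P₀,1)`. -/
theorem integrableOn_spEta_right : IntegrableOn spEta (Ioo sP0 1) :=
  integrableOn_spEta.mono_set (Ioo_subset_Ioo_left sP0_pos.le)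

/-! ## Semialgebraicity -/

/-- `line (0,P₀)` is `ℚ`-semialgebraic. -/
theorem sp_lineL_sa : IsSemialgebraic ℚ (line (Ioo 0 sP0)) :=
  isSemialgebraic_line_Ioo isAlgebraic_zero isAlgebraic_sP0

/-- `line (P₀,1)` is `ℚ`-semialgebraic. -/
theorem sp_lineR_sa : IsSemialgebraic ℚ (line (Ioo sP0 1)) :=
  isSemialgebraic_line_Ioo isAlgebraic_sP0 isAlgebraic_one

/-- `W^{-1/2}(1-W²)^{-5/6}` is `ℚ`-semialgebraic on any `ℚ`-semialgebraic part of `(0,1)`. -/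
theorem sa_spPow {S : Set ℝ} (hS : IsSemialgebraic ℚ (line S)) (hsub : S ⊆ Ioo (0:ℝ) 1) :
    IsSemialgebraicFunOn ℚ (line S)
      (fun x : Fin 1 → ℝ => x 0 ^ (-(1 / 2 : ℝ)) * (1 - x 0 ^ 2) ^ (-(5 / 6 : ℝ))) := by
  have hX := sa_coord hS
  have h1 : IsSemialgebraicFunOn ℚ (line S) (fun x : Fin 1 → ℝ => 1 - x 0 ^ 2) :=
    (IsSemialgebraicFunOn.sub_holds (isSemialgebraicFunOn_const_of_isAlgebraic hS isAlgebraic_one)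
      (IsSemialgebraicFunOn.mul_holds hX hX)).congr fun x _ => by
        simp only [Pi.sub_apply, Pi.mul_apply]; ring
  have hA := IsSemialgebraicFunOn.rpow_ratCast hS hX (fun x hx => (hsub hx).1) (-(1 / 2))
  have hB := IsSemialgebraicFunOn.rpow_ratCast hS h1
    (fun x hx => by have h := hsub hx; nlinarith [h.1, h.2]) (-(5 / 6))
  refine (IsSemialgebraicFunOn.mul_holds hA hB).congr fun x _ => ?_
  simp only [Pi.mul_apply]
  norm_num

/-- `η` is `ℚ`-semialgebraic on any `ℚ`-semialgebraic part of `(0,1)`. -/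
theorem sa_spEta {S : Set ℝ} (hS : IsSemialgebraic ℚ (line S)) (hsub : S ⊆ Ioo (0:ℝ) 1) :
    IsSemialgebraicFunOn ℚ (line S) (fun x : Fin 1 → ℝ => spEta (x 0)) :=
  (IsSemialgebraicFunOn.mul_holds (isSemialgebraicFunOn_const_of_isAlgebraic hS isAlgebraic_spC)
    (IsSemialgebraicFunOn.mul_holds (sa_spPow hS hsub)
      (IsSemialgebraicFunOn.add_holds (sa_coord hS)
        (isSemialgebraicFunOn_const_of_isAlgebraic hS isAlgebraic_sW0)))).congr
    fun x _ => by simp only [spEta, Pi.mul_apply, Pi.add_apply]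

/-- `η` on `line (0,1)`. -/
theorem sa_spEta_unit : IsSemialgebraicFunOn ℚ (line (Ioo (0:ℝ) 1)) (fun x => spEta (x 0)) :=
  sa_spEta mix_line_sa fun _ h => h

/-- `η` on `line (0,P₀)`. -/
theorem sa_spEta_left : IsSemialgebraicFunOn ℚ (line (Ioo 0 sP0)) (fun x => spEta (x 0)) :=
  sa_spEta sp_lineL_sa fun _ h => ⟨h.1, h.2.trans sP0_lt_one⟩

/-- `η` on `line (P₀,1)`. -/
theorem sa_spEta_right : IsSemialgebraicFunOn ℚ (line (Ioo sP0 1)) (fun x => spEta (x 0)) :=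
  sa_spEta sp_lineR_sa fun _ h => ⟨sP0_pos.trans h.1, h.2⟩

/-- `g₊` is `ℚ`-semialgebraic on `(0,1)`. -/
theorem sa_spGp : IsSemialgebraicFunOn ℚ (line (Ioo (0:ℝ) 1)) (fun x => spGp (x 0)) :=
  (IsSemialgebraicFunOn.mul_holds
    (IsSemialgebraicFunOn.mul_holds (isSemialgebraicFunOn_const_of_isAlgebraic mix_line_sa
      (by simpa using isAlgebraic_rat ℚ (A := ℝ) 2)) (sa_coord mix_line_sa))
    (sa_spPow mix_line_sa fun _ h => h)).congr fun x _ => by simp only [spGp, Pi.mul_apply]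

/-- `g₀` is `ℚ`-semialgebraic on `(0,1)`. -/
theorem sa_spG0 : IsSemialgebraicFunOn ℚ (line (Ioo (0:ℝ) 1)) (fun x => spG0 (x 0)) :=
  (IsSemialgebraicFunOn.mul_holds (isSemialgebraicFunOn_const_of_isAlgebraic mix_line_sa
      (by simpa using isAlgebraic_rat ℚ (A := ℝ) 2)) (sa_spPow mix_line_sa fun _ h => h)).congr
    fun x _ => by simp only [spG0, Pi.mul_apply]

/-- `F` is `ℚ`-semialgebraic on `(0,P₀)` (a rational function with algebraic coefficients). -/
theorem sa_spF : IsSemialgebraicFunOn ℚ (line (Ioo 0 sP0)) (fun x => spF (x 0)) := by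
  have hS := sp_lineL_sa
  have hX := sa_coord hS
  have hA : IsSemialgebraicFunOn ℚ (line (Ioo 0 sP0)) (fun x : Fin 1 → ℝ => sP0 - x 0) :=
    (IsSemialgebraicFunOn.sub_holds (isSemialgebraicFunOn_const_of_isAlgebraic hS isAlgebraic_sP0)
      hX).congr fun x _ => by simp only [Pi.sub_apply]
  have hN : IsSemialgebraicFunOn ℚ (line (Ioo 0 sP0)) (fun x : Fin 1 → ℝ => (sP0 - x 0) ^ 3) :=
    (IsSemialgebraicFunOn.mul_holds (IsSemialgebraicFunOn.mul_holds hA hA) hA).congr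
      fun x _ => by simp only [Pi.mul_apply]; ring
  have hD : IsSemialgebraicFunOn ℚ (line (Ioo 0 sP0))
      (fun x : Fin 1 → ℝ => sP0 ^ 3 * (1 - x 0 ^ 2)) :=
    (IsSemialgebraicFunOn.mul_holds
      (isSemialgebraicFunOn_const_of_isAlgebraic hS (isAlgebraic_sP0.pow 3))
      (IsSemialgebraicFunOn.sub_holds (isSemialgebraicFunOn_const_of_isAlgebraic hS
        isAlgebraic_one) (IsSemialgebraicFunOn.mul_holds hX hX))).congr
      fun x _ => by simp only [Pi.mul_apply, Pi.sub_apply]; ring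
  exact (IsSemialgebraicFunOn.div hN hD fun x hx =>
    (spF_den_pos hx.1 (lt_trans hx.2 sP0_lt_one)).ne').congr fun x _ => by
      simp only [spF]

/-- `τ` is `ℚ`-semialgebraic on `(P₀,1)`. -/
theorem sa_spT : IsSemialgebraicFunOn ℚ (line (Ioo sP0 1)) (fun x => spT (x 0)) := by
  have hS := sp_lineR_sa
  have hX := sa_coord hS
  have hA : IsSemialgebraicFunOn ℚ (line (Ioo sP0 1)) (fun x : Fin 1 → ℝ => x 0 - sP0) :=
    (IsSemialgebraicFunOn.sub_holds hX (isSemialgebraicFunOn_const_of_isAlgebraic hS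
      isAlgebraic_sP0)).congr fun x _ => by simp only [Pi.sub_apply]
  have hB : IsSemialgebraicFunOn ℚ (line (Ioo sP0 1)) (fun x : Fin 1 → ℝ => sP1 - x 0) :=
    (IsSemialgebraicFunOn.sub_holds (isSemialgebraicFunOn_const_of_isAlgebraic hS
      isAlgebraic_sP1) hX).congr fun x _ => by simp only [Pi.sub_apply]
  have hN : IsSemialgebraicFunOn ℚ (line (Ioo sP0 1)) (fun x : Fin 1 → ℝ => (x 0 - sP0) ^ 3) :=
    (IsSemialgebraicFunOn.mul_holds (IsSemialgebraicFunOn.mul_holds hA hA) hA).congr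
      fun x _ => by simp only [Pi.mul_apply]; ring
  have hD : IsSemialgebraicFunOn ℚ (line (Ioo sP0 1))
      (fun x : Fin 1 → ℝ => x 0 * (sP1 - x 0) ^ 2) :=
    (IsSemialgebraicFunOn.mul_holds hX (IsSemialgebraicFunOn.mul_holds hB hB)).congr
      fun x _ => by simp only [Pi.mul_apply]; ring
  exact (IsSemialgebraicFunOn.div hN hD fun x hx =>
    (spT_den_pos (sP0_pos.trans hx.1) hx.2).ne').congr fun x _ => by
      simp only [spT]

end SoloBlind

end Summit.KontsevichZagierPeriods.KontsevichZagierPeriods.Theorems
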